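import Summits.QuantumFields.YangMills.Theorems.LangevinControlUVFemtoCurvatureTwoPointStrictRPSiteTransfer
import Literature.MathematicalPhysics.QuantumFieldTheory.FlatLatticeGaugeFields

/-!
# Crux `FemtoCurvatureTwoPoint` (stmt-QuantumFields-9363, route `LangevinControlUV`):
# strict positivity of the axis covariance, VII — transfer form of the slab functional

Helper for the registered sub-goal `stub_axisPositive` (`--supports stmt-QuantumFields-9363`).
**Transfer form** (`chiR_eq_integral_sliceKernel`): for a spatial plaquette `q` at time `1`, the
real slab functional of the site reflection equals
`χ_ℝ(V) = ∫ (Re tr ρ(W_q) − m) · exp(β rest(splice(V, W))) · K_{E₁}(shiftDown V, W) dW` —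
resample the temporal links `0 → 1`, recognise the slice kernel composed with a gauge
transformation supported on the slice `t = 1` (part VI), swap the two resamplings (Fubini), and
remove the gauge transformation by the gauge invariance of the product Haar measure
(`WilsonGauge.measurePreserving_gaugeTransform`) and of the plaquette traces. With bounded,
measurable and continuous versions of the pieces.
-/

set_option autoImplicit false

noncomputable section

namespace Summit.QuantumFields.YangMills.Theorems.FemtoCurvatureTwoPoint.StrictRP

open MeasureTheory Finset
open scoped Matrix ComplexConjugate
open Literature.MathematicalPhysics.QuantumFieldTheory

section TransferForm

variable {d L N : ℕ} [NeZero d] [NeZero L] [Fact (1 < L)] {G : Type*} [Group G]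
  [TopologicalSpace G] [IsTopologicalGroup G] [CompactSpace G] [MeasurableSpace G] [BorelSpace G]
  (ρ : G →* Matrix (Fin N) (Fin N) ℂ)

omit [Fact (1 < L)] [TopologicalSpace G] [IsTopologicalGroup G] [CompactSpace G] [MeasurableSpace G]
  [BorelSpace G] in
/-- The rest of the action is gauge invariant. [folklore] -/
theorem restAction_gaugeTransform (g : Site d L → G) (U : GaugeConfig d L G) :
    restAction ρ (gaugeTransform g U) = restAction ρ U := by
  unfold restAction
  exact Finset.sum_congr rfl fun p _ => plaqRe_gaugeTransform ρ g U p

omit [NeZero d] [NeZero L] [Fact (1 < L)] [CompactSpace G] in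
/-- A filtered sum of plaquette functions is measurable. [folklore] -/
theorem measurable_sum_plaqRe (hρ : Continuous ρ) (s : Finset (Plaquette d L)) :
    Measurable fun U : GaugeConfig d L G => ∑ p ∈ s, WilsonRP.plaqRe ρ U p :=
  Finset.measurable_sum _ fun p _ => WilsonRP.measurable_plaqRe ρ hρ p

omit [NeZero d] [NeZero L] [Fact (1 < L)] [CompactSpace G] [MeasurableSpace G] [BorelSpace G] in
/-- A filtered sum of plaquette functions is continuous. [folklore] -/
theorem continuous_sum_plaqRe (hρ : Continuous ρ) (s : Finset (Plaquette d L)) :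
    Continuous fun U : GaugeConfig d L G => ∑ p ∈ s, WilsonRP.plaqRe ρ U p :=
  continuous_finsetSum _ fun p _ => continuous_plaqRe ρ hρ p

omit [NeZero d] [Fact (1 < L)] [MeasurableSpace G] [BorelSpace G] in
/-- A filtered sum of plaquette functions is bounded by `N · #plaquettes`. [folklore] -/
theorem abs_sum_plaqRe_le (hρ : Continuous ρ) (s : Finset (Plaquette d L)) (U : GaugeConfig d L G) :
    |∑ p ∈ s, WilsonRP.plaqRe ρ U p| ≤ N * Fintype.card (Plaquette d L) := by
  calc |∑ p ∈ s, WilsonRP.plaqRe ρ U p| ≤ ∑ p ∈ s, |WilsonRP.plaqRe ρ U p| := Finset.abs_sum_le_sum_abs _ _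
    _ ≤ ∑ _p ∈ s, (N : ℝ) := Finset.sum_le_sum fun p _ => WilsonRP.abs_plaqRe_le ρ hρ U p
    _ = s.card * N := by rw [Finset.sum_const, nsmul_eq_mul]
    _ ≤ Fintype.card (Plaquette d L) * N := by
        exact mul_le_mul_of_nonneg_right (by exact_mod_cast Finset.card_le_univ s) (Nat.cast_nonneg _)
    _ = N * Fintype.card (Plaquette d L) := mul_comm _ _

omit [NeZero d] [NeZero L] [Fact (1 < L)] [IsTopologicalGroup G] [CompactSpace G] in
/-- The slice kernel is measurable in its second argument. [folklore] -/
theorem measurable_sliceKernel (hρ : Continuous ρ) (β : ℝ) (E : Finset (Edge d L)) (A : GaugeConfig d L G) :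
    Measurable (sliceKernel ρ β E A) := by
  unfold sliceKernel pairing
  refine (measurable_const.mul (Finset.measurable_sum _ fun e _ => ?_)).exp
  have hW : WilsonRP.EntryMeasurable ρ fun W : GaugeConfig d L G => W e :=
    WilsonRP.entryMeasurable_apply hρ e
  simp only [Matrix.trace, Matrix.diag_apply, Matrix.mul_apply, Matrix.conjTranspose_apply,
    Complex.re_sum]
  refine Finset.measurable_sum _ fun a _ => Finset.measurable_sum _ fun b _ => ?_
  exact Complex.measurable_re.comp (measurable_const.mul
    (Complex.continuous_conj.measurable.comp (hW a b)))

omit [NeZero d] [NeZero L] [Fact (1 < L)] [TopologicalSpace G] [IsTopologicalGroup G] [CompactSpace G]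
  [MeasurableSpace G] [BorelSpace G] in
/-- The slice kernel is bounded (unitary representation, `β ≥ 0`). [folklore] -/
theorem abs_sliceKernel_le (hunit : ∀ g, ρ g ∈ Matrix.unitaryGroup (Fin N) ℂ) {β : ℝ} (hβ : 0 ≤ β)
    (E : Finset (Edge d L)) (A W : GaugeConfig d L G) :
    |sliceKernel ρ β E A W| ≤ Real.exp (β * (E.card * (2 * (N : ℝ) ^ 2))) := by
  have hpair : ∀ g h : G, pairing ρ g h ≤ 2 * (N : ℝ) ^ 2 := by
    intro g h
    rw [pairing_eq_sum]
    calc ∑ a, ∑ b, ((ρ g a b).re * (ρ h a b).re + (ρ g a b).im * (ρ h a b).im)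
        ≤ ∑ _a : Fin N, ∑ _b : Fin N, (2 : ℝ) :=
          Finset.sum_le_sum fun a _ => Finset.sum_le_sum fun b _ => ?_
      _ = 2 * (N : ℝ) ^ 2 := by
          simp only [Finset.sum_const, Finset.card_univ, Fintype.card_fin, nsmul_eq_mul]; ring
    have hg1 := entry_norm_bound_of_unitary (hunit g) a b
    have hh1 := entry_norm_bound_of_unitary (hunit h) a b
    have e1 : |(ρ g a b).re| ≤ 1 := (Complex.abs_re_le_norm _).trans hg1
    have e2 : |(ρ h a b).re| ≤ 1 := (Complex.abs_re_le_norm _).trans hh1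
    have e3 : |(ρ g a b).im| ≤ 1 := (Complex.abs_im_le_norm _).trans hg1
    have e4 : |(ρ h a b).im| ≤ 1 := (Complex.abs_im_le_norm _).trans hh1
    have p1 : (ρ g a b).re * (ρ h a b).re ≤ 1 :=
      (le_abs_self _).trans (by rw [abs_mul]; exact mul_le_one₀ e1 (abs_nonneg _) e2)
    have p2 : (ρ g a b).im * (ρ h a b).im ≤ 1 :=
      (le_abs_self _).trans (by rw [abs_mul]; exact mul_le_one₀ e3 (abs_nonneg _) e4)
    linarith
  unfold sliceKernel
  rw [abs_of_pos (Real.exp_pos _)]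
  refine Real.exp_le_exp.2 (mul_le_mul_of_nonneg_left ?_ hβ)
  calc ∑ e ∈ E, pairing ρ (A e) (W e) ≤ ∑ _e ∈ E, (2 * (N : ℝ) ^ 2) :=
        Finset.sum_le_sum fun e _ => hpair _ _
    _ = E.card * (2 * (N : ℝ) ^ 2) := by rw [Finset.sum_const, nsmul_eq_mul]

omit [NeZero d] [NeZero L] [Fact (1 < L)] [TopologicalSpace G] [IsTopologicalGroup G] [CompactSpace G]
  [MeasurableSpace G] [BorelSpace G] in
/-- The slice kernel only reads the first argument on `E`. [folklore] -/
theorem sliceKernel_congr_left {β : ℝ} {E : Finset (Edge d L)} {A A' : GaugeConfig d L G}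
    (h : ∀ e ∈ E, A e = A' e) (W : GaugeConfig d L G) :
    sliceKernel ρ β E A W = sliceKernel ρ β E A' W := by
  unfold sliceKernel
  congr 2
  exact Finset.sum_congr rfl fun e he => by rw [h e he]

/-- **Transfer form of the slab functional.** For a spatial plaquette `q` at time `1`:
`χ_ℝ(V) = ∫ (Re tr ρ(W_q) − m) · exp(β rest(splice(V, W))) · K_{E₁}(shiftDown V, W) dW`
— resample the temporal links `0 → 1`, recognise the slice kernel composed with a gauge
transformation supported on the slice `t = 1`, and remove the gauge transformation by the gauge
invariance of the product Haar measure and of the rest of the action. [folklore] -/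
theorem chiR_eq_integral_sliceKernel (hL4 : 4 ≤ L) (hρ : Continuous ρ)
    (hunit : ∀ g, ρ g ∈ Matrix.unitaryGroup (Fin N) ℂ) {β : ℝ} (hβ : 0 ≤ β)
    {q : Plaquette d L} (hq : q.2.1.1 ≠ 0) (hqt : (q.1 0).val = 1) (m : ℝ) (V : GaugeConfig d L G) :
    chiR ρ β q m V = ∫ W, (WilsonRP.plaqRe ρ W q - m) *
        Real.exp (β * restAction ρ (LatticeRP.splice WilsonSiteRP.sitePosEdges (V, W))) *
        sliceKernel ρ β sliceOneEdges (shiftDown V) W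
      ∂(LatticeRP.piMeasure (ι := Edge d L) (haarProbability G)) := by
  classical
  set μ : Measure (GaugeConfig d L G) := LatticeRP.piMeasure (ι := Edge d L) (haarProbability G)
    with hμ
  set P' : Finset (Edge d L) := WilsonSiteRP.sitePosEdges with hP'
  -- the gauge-invariant factor
  set s : GaugeConfig d L G → ℝ := fun W => (WilsonRP.plaqRe ρ W q - m) *
    Real.exp (β * restAction ρ (LatticeRP.splice P' (V, W))) with hs
  have hB : 0 ≤ (N : ℝ) * Fintype.card (Plaquette d L) := by positivity
  set CB : ℝ := Real.exp (β * (N * Fintype.card (Plaquette d L))) with hCB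
  have hexp_rest : ∀ U : GaugeConfig d L G, |Real.exp (β * restAction ρ U)| ≤ CB := fun U => by
    rw [abs_of_pos (Real.exp_pos _)]
    refine Real.exp_le_exp.2 (mul_le_mul_of_nonneg_left ?_ hβ)
    exact (le_abs_self _).trans (abs_sum_plaqRe_le ρ hρ _ U)
  have hexp_low : ∀ U : GaugeConfig d L G, |Real.exp (β * lowAction ρ U)| ≤ CB := fun U => by
    rw [abs_of_pos (Real.exp_pos _)]
    refine Real.exp_le_exp.2 (mul_le_mul_of_nonneg_left ?_ hβ)
    exact (le_abs_self _).trans (abs_sum_plaqRe_le ρ hρ _ U)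
  have hsm : Measurable s := ((WilsonRP.measurable_plaqRe ρ hρ q).sub_const m).mul
    (((measurable_sum_plaqRe ρ hρ _).comp ((LatticeRP.measurable_splice P').comp
      (measurable_const.prodMk measurable_id))).const_mul β).exp
  have hsb : ∀ W, |s W| ≤ (N + |m|) * CB := fun W => by
    rw [hs, abs_mul]
    exact mul_le_mul ((abs_sub _ _).trans (add_le_add (WilsonRP.abs_plaqRe_le ρ hρ W q) le_rfl))
      (hexp_rest _) (abs_nonneg _) (by positivity)
  -- step 1: split the positive action
  have step1 : chiR ρ β q m V = ∫ W, s W *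
      Real.exp (β * lowAction ρ (LatticeRP.splice P' (V, W))) ∂μ := by
    unfold chiR
    refine integral_congr_ae (ae_of_all _ fun W => ?_)
    dsimp only
    rw [plaqRe_splice_sitePos_of_spatial ρ hL4 hq hqt, sitePosAction_eq_add, mul_add, Real.exp_add]
    ring
  -- step 2: resample the temporal links `0 → 1`
  have hΦm : Measurable fun W => s W * Real.exp (β * lowAction ρ (LatticeRP.splice P' (V, W))) :=
    hsm.mul (((measurable_sum_plaqRe ρ hρ _).comp ((LatticeRP.measurable_splice P').comp
      (measurable_const.prodMk measurable_id))).const_mul β).exp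
  have hΦb : ∀ W, |s W * Real.exp (β * lowAction ρ (LatticeRP.splice P' (V, W)))| ≤
      (N + |m|) * CB * CB := fun W => by
    rw [abs_mul]
    exact mul_le_mul (hsb W) (hexp_low _) (abs_nonneg _) (by positivity)
  have step2 := integral_eq_integral_integral_splice (lowEdges : Finset (Edge d L)) hΦm hΦb
  -- step 3: the resampled integrand, pointwise
  have hs_splice : ∀ W Y, s (LatticeRP.splice lowEdges (W, Y)) = s W := by
    intro W Y
    have hagree : ∀ e : Edge d L, (e.1 0).val ≠ 0 → LatticeRP.splice lowEdges (W, Y) e = W e := by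
      intro e he
      have : e ∉ (lowEdges : Finset (Edge d L)) := fun h => he (mem_lowEdges.1 h).2
      simp only [LatticeRP.splice_apply, if_neg this]
    simp only [hs]
    rw [plaqRe_congr_of_spatial ρ hq (by rw [hqt]; exact one_ne_zero) hagree]
    congr 3
    refine restAction_congr ρ hL4 fun e he => ?_
    simp only [LatticeRP.splice_apply]
    split_ifs with h1 h2
    · exact absurd (mem_lowEdges.1 h2).2 he
    · rfl
    · rfl
  have hpt : ∀ W Y, s (LatticeRP.splice lowEdges (W, Y)) *
      Real.exp (β * lowAction ρ (LatticeRP.splice P' (V, LatticeRP.splice lowEdges (W, Y)))) =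
      s W * sliceKernel ρ β sliceOneEdges (shiftDown V) (gaugeTransform (gaugeOf Y) W) := by
    intro W Y
    rw [hs_splice]
    congr 1
    exact exp_lowAction_lowSplice ρ hL4 hunit β V W Y
  -- step 4: swap the two resamplings
  have hswap : ∫ W, ∫ Y, s (LatticeRP.splice lowEdges (W, Y)) *
      Real.exp (β * lowAction ρ (LatticeRP.splice P' (V, LatticeRP.splice lowEdges (W, Y)))) ∂μ ∂μ =
      ∫ Y, ∫ W, s (LatticeRP.splice lowEdges (W, Y)) *
      Real.exp (β * lowAction ρ (LatticeRP.splice P' (V, LatticeRP.splice lowEdges (W, Y)))) ∂μ ∂μ := by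
    refine integral_integral_swap ?_
    refine Integrable.of_bound ((hΦm.comp (LatticeRP.measurable_splice lowEdges)).aestronglyMeasurable)
      ((N + |m|) * CB * CB) (ae_of_all _ fun p => ?_)
    rw [Real.norm_eq_abs]
    exact hΦb _
  -- step 5: remove the gauge transformation for each `Y`
  have hinner : ∀ Y, ∫ W, s W * sliceKernel ρ β sliceOneEdges (shiftDown V)
      (gaugeTransform (gaugeOf Y) W) ∂μ =
      ∫ W, s W * sliceKernel ρ β sliceOneEdges (shiftDown V) W ∂μ := by
    intro Y
    set γ : Site d L → G := gaugeOf Y with hγ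
    set g : Site d L → G := fun x => (γ x)⁻¹ with hg
    have hγs : ∀ x : Site d L, (x 0).val ≠ 1 → γ x = 1 := fun x hx => gaugeOf_of_ne Y hx
    have hgs : ∀ x : Site d L, (x 0).val ≠ 1 → g x = 1 := fun x hx => by
      simp only [hg, hγs x hx, inv_one]
    have hsinv : ∀ W, s (gaugeTransform g W) = s W := fun W => by
      simp only [hs]
      rw [plaqRe_gaugeTransform, splice_gaugeTransform hL4 hgs, restAction_gaugeTransform]
    have hφm : Measurable fun W => s (gaugeTransform g W) *
        sliceKernel ρ β sliceOneEdges (shiftDown V) W :=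
      (hsm.comp (WilsonGauge.measurePreserving_gaugeTransform g).measurable).mul
        (measurable_sliceKernel ρ hρ β _ _)
    have hcv := integral_comp_eq_of_measurePreserving_real
      (WilsonGauge.measurePreserving_gaugeTransform (d := d) (L := L) (G := G) γ) hφm
    have hgg : ∀ W : GaugeConfig d L G, gaugeTransform g (gaugeTransform γ W) = W := fun W =>
      gaugeTransform_inv_gaugeTransform γ W
    simp only [hgg] at hcv
    rw [hcv]
    exact integral_congr_ae (ae_of_all _ fun W => by dsimp only; rw [hsinv])
  -- assemble
  rw [step1, step2, hswap]
  simp_rw [hpt, hinner]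
  rw [integral_const, probReal_univ, one_smul]

end TransferForm

/-- **Registered sub-goal `stub_slabTransferForm`** (`--supports stmt-QuantumFields-9363`): closed form of `chiR_eq_integral_sliceKernel` — the transfer form of the slab functional. [folklore] -/
theorem stub_slabTransferForm : ∀ (d L N : ℕ) [NeZero d] [NeZero L] [Fact (1 < L)] (G : Type) [Group G] [TopologicalSpace G] [IsTopologicalGroup G] [CompactSpace G] [MeasurableSpace G] [BorelSpace G] (ρ : G →* Matrix (Fin N) (Fin N) ℂ), 4 ≤ L → Continuous ρ → (∀ g, ρ g ∈ Matrix.unitaryGroup (Fin N) ℂ) → ∀ (β : ℝ), 0 ≤ β → ∀ (q : Literature.MathematicalPhysics.QuantumFieldTheory.Plaquette d L), q.2.1.1 ≠ 0 → (q.1 0).val = 1 → ∀ (m : ℝ) (V : Literature.MathematicalPhysics.QuantumFieldTheory.GaugeConfig d L G), Summit.QuantumFields.YangMills.Theorems.FemtoCurvatureTwoPoint.StrictRP.chiR ρ β q m V = ∫ W, (Literature.MathematicalPhysics.QuantumFieldTheory.WilsonRP.plaqRe ρ W q - m) * Real.exp (β * Summit.QuantumFields.YangMills.Theorems.FemtoCurvatureTwoPoint.StrictRP.restAction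 ρ (Literature.MathematicalPhysics.QuantumFieldTheory.LatticeRP.splice Literature.MathematicalPhysics.QuantumFieldTheory.WilsonSiteRP.sitePosEdges (V, W))) * Summit.QuantumFields.YangMills.Theorems.FemtoCurvatureTwoPoint.StrictRP.sliceKernel ρ β Summit.QuantumFields.YangMills.Theorems.FemtoCurvatureTwoPoint.StrictRP.sliceOneEdges (Summit.QuantumFields.YangMills.Theorems.FemtoCurvatureTwoPoint.StrictRP.shiftDown V) W ∂(Literature.MathematicalPhysics.QuantumFieldTheory.LatticeRP.piMeasure (ι := Literature.MathematicalPhysics.QuantumFieldTheory.Edge d L) (Literature.MathematicalPhysics.QuantumFieldTheory.haarProbability G)) := by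
  intro d L N _ _ _ G _ _ _ _ _ _ ρ hL4 hρ hunit β hβ q hq hqt m V
  exact chiR_eq_integral_sliceKernel ρ hL4 hρ hunit hβ hq hqt m V

end Summit.QuantumFields.YangMills.Theorems.FemtoCurvatureTwoPoint.StrictRP

end
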